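import Summits.Ventures.YMGap.Thresholds.ZdSmoothingLipschitz
import Summits.Ventures.YMGap.Thresholds.StarLimitLipschitz
import Literature.MathematicalPhysics.QuantumFieldTheory.Sweep1ShenZhuZhuProofs
import HarnessLib

/-!
# Venture YMGap — tools for the C-DIFF line: limits of derivatives (FTC form), products of Lipschitz cylinder
# functions, and convergence of torus covariances to the unique DLR state

HONEST FRAMING: venture file of the cell `pub-ymgap` (QuantumFields programme), seat ds-1.  Three generic tools,
no lattice number, nothing about the continuum or the Clay problem:

* §1 CALCULUS.  `intervalIntegral_eq_sub_of_hasDerivAt_of_abs_le` — FTC for a function with a bounded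
  derivative on `[a, c]`; `intervalIntegral_eq_sub_of_tendsto` — if `φₙ → Φ` and `φₙ' = Dₙ → g` pointwise on
  `[a, c]` with `|Dₙ| ≤ B`, then `∫_s^t g = Φ t − Φ s` (dominated convergence under the integral sign);
  `hasDerivAt_of_intervalIntegral_eq` — if `∫_a^t g = Φ t − Φ a` on `[a, c]` and `g` is continuous on `[a, c]`,
  then `Φ' = g` on `(a, c)`.
* §2 OBSERVABLES.  `isLipschitzCylinder_mul` — the product of two bounded Lipschitz cylinder functions of `SU(N)`
  gauge fields is a Lipschitz cylinder function on the union of the supports, constant `M₁K₂ + M₂K₁`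
  (McShane packaging `isLipschitzCylinder_of_dist_le`).
* §3 STATES.  `tendsto_cov_torusState_of_subsingleton` — if the DLR state at coupling `β` is unique, torus
  covariances of bounded continuous observables converge to its covariances (three applications of the tree's
  `tendsto_integral_torusState_of_subsingleton`).

References (mechanism only): W. Rudin, *Principles of Mathematical Analysis*, Thm. 7.17 (limits of derivatives);
S. Friedli, Y. Velenik (2017), Lemma 6.30.
-/

noncomputable section

open MeasureTheory ProbabilityTheory Function Finset Filter Topology Set
open scoped NNReal Interval
open Literature.MathematicalPhysics.QuantumLattice (LGConfig ZdEdge fundamentalRep ymGibbsMeasures)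
open Literature.MathematicalPhysics.QuantumFieldTheory hiding ZdEdge

namespace Summit.Ventures.YMGap.CouplingResponse

/-! ### §1 Calculus: limits of derivatives in FTC form -/

section Calculus

/-- A function equal on `[a, c]` to a globally measurable function and bounded there by `B` is interval
integrable between any two points of `[a, c]`. [folklore] -/
theorem intervalIntegrable_of_eqOn_of_abs_le {D D' : ℝ → ℝ} {a c B : ℝ} (hm : Measurable D')
    (heq : EqOn D D' (Icc a c)) (hB : ∀ u ∈ Icc a c, |D u| ≤ B) {s t : ℝ} (hs : s ∈ Icc a c) (ht : t ∈ Icc a c) :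
    IntervalIntegrable D volume s t := by
  have hsub : Ι s t ⊆ Icc a c := uIoc_subset_uIcc.trans (uIcc_subset_Icc hs ht)
  have hD'int : IntervalIntegrable D' volume s t := by
    refine (intervalIntegrable_const (c := B)).mono_fun' hm.aestronglyMeasurable ?_
    refine ae_restrict_of_forall_mem measurableSet_uIoc fun u hu => ?_
    show ‖D' u‖ ≤ B
    rw [Real.norm_eq_abs, ← heq (hsub hu)]
    exact hB u (hsub hu)
  exact hD'int.congr fun u hu => (heq (hsub hu)).symm

/-- **FTC with a bounded derivative on a segment**: if `φ' = D` on `[a, c]` and `|D| ≤ B` there, then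
`∫_s^t D = φ t − φ s` for all `s, t ∈ [a, c]`. [folklore] -/
theorem intervalIntegral_eq_sub_of_hasDerivAt_of_abs_le {φ D : ℝ → ℝ} {a c B : ℝ}
    (hderiv : ∀ u ∈ Icc a c, HasDerivAt φ (D u) u) (hB : ∀ u ∈ Icc a c, |D u| ≤ B)
    {s t : ℝ} (hs : s ∈ Icc a c) (ht : t ∈ Icc a c) :
    ∫ u in s..t, D u = φ t - φ s := by
  have hsub : uIcc s t ⊆ Icc a c := uIcc_subset_Icc hs ht
  have heq : EqOn D (deriv φ) (Icc a c) := fun u hu => ((hderiv u hu).deriv).symm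
  exact intervalIntegral.integral_eq_sub_of_hasDerivAt (fun u hu => hderiv u (hsub hu))
    (intervalIntegrable_of_eqOn_of_abs_le (measurable_deriv φ) heq hB hs ht)

/-- **Limits of derivatives, FTC form** (Rudin, Thm. 7.17, integrated): if on `[a, c]` every `φₙ` has derivative
`Dₙ` with `|Dₙ| ≤ B`, `φₙ → Φ` and `Dₙ → g` pointwise, then `∫_s^t g = Φ t − Φ s` for all `s, t ∈ [a, c]`
(dominated convergence). [folklore] -/
theorem intervalIntegral_eq_sub_of_tendsto {φ D : ℕ → ℝ → ℝ} {Φ g : ℝ → ℝ} {a c B : ℝ}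
    (hderiv : ∀ n, ∀ u ∈ Icc a c, HasDerivAt (φ n) (D n u) u) (hB : ∀ n, ∀ u ∈ Icc a c, |D n u| ≤ B)
    (hφ : ∀ u ∈ Icc a c, Tendsto (fun n => φ n u) atTop (𝓝 (Φ u)))
    (hD : ∀ u ∈ Icc a c, Tendsto (fun n => D n u) atTop (𝓝 (g u)))
    {s t : ℝ} (hs : s ∈ Icc a c) (ht : t ∈ Icc a c) :
    ∫ u in s..t, g u = Φ t - Φ s := by
  have hsub : Ι s t ⊆ Icc a c := uIoc_subset_uIcc.trans (uIcc_subset_Icc hs ht)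
  have hn : ∀ n, ∫ u in s..t, D n u = φ n t - φ n s := fun n =>
    intervalIntegral_eq_sub_of_hasDerivAt_of_abs_le (hderiv n) (hB n) hs ht
  have hlim₁ : Tendsto (fun n => ∫ u in s..t, D n u) atTop (𝓝 (Φ t - Φ s)) := by
    simp_rw [hn]; exact (hφ t ht).sub (hφ s hs)
  have hlim₂ : Tendsto (fun n => ∫ u in s..t, D n u) atTop (𝓝 (∫ u in s..t, g u)) := by
    refine intervalIntegral.tendsto_integral_filter_of_dominated_convergence (fun _ => B) ?_ ?_ ?_ ?_
    · refine Eventually.of_forall fun n => ?_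
      have heq : EqOn (D n) (deriv (φ n)) (Icc a c) := fun u hu => ((hderiv n u hu).deriv).symm
      exact (measurable_deriv (φ n)).aestronglyMeasurable.congr
        (ae_restrict_of_forall_mem measurableSet_uIoc fun u hu => (heq (hsub hu)).symm)
    · refine Eventually.of_forall fun n => ae_of_all _ fun u hu => ?_
      rw [Real.norm_eq_abs]; exact hB n u (hsub hu)
    · exact intervalIntegrable_const
    · exact ae_of_all _ fun u hu => hD u (hsub hu)
  exact (tendsto_nhds_unique hlim₂ hlim₁)

/-- **From the integral formula to the derivative**: if `∫_a^t g = Φ t − Φ a` for `t ∈ [a, c]` and `g` is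
continuous on `[a, c]`, then `Φ` is differentiable at every interior point `t₀` with `Φ'(t₀) = g t₀` (FTC-1).
[folklore] -/
theorem hasDerivAt_of_intervalIntegral_eq {Φ g : ℝ → ℝ} {a c : ℝ}
    (hint : ∀ t ∈ Icc a c, ∫ u in a..t, g u = Φ t - Φ a) (hg : ContinuousOn g (Icc a c))
    {t₀ : ℝ} (ht₀ : t₀ ∈ Ioo a c) : HasDerivAt Φ (g t₀) t₀ := by
  have hgi : IntervalIntegrable g volume a t₀ :=
    (hg.mono (uIcc_subset_Icc (left_mem_Icc.2 (ht₀.1.le.trans ht₀.2.le)) (Ioo_subset_Icc_self ht₀))).intervalIntegrable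
  have hmeas : StronglyMeasurableAtFilter g (𝓝 t₀) volume :=
    ContinuousOn.stronglyMeasurableAtFilter isOpen_Ioo (hg.mono Ioo_subset_Icc_self) t₀ ht₀
  have hcont : ContinuousAt g t₀ := hg.continuousAt (Icc_mem_nhds ht₀.1 ht₀.2)
  have h := (intervalIntegral.integral_hasDerivAt_right hgi hmeas hcont).const_add (Φ a)
  refine h.congr_of_eventuallyEq ?_
  filter_upwards [Ioo_mem_nhds ht₀.1 ht₀.2] with t ht
  rw [hint t (Ioo_subset_Icc_self ht)]
  ring

end Calculus

/-! ### §2 Products of Lipschitz cylinder functions -/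

section Product

variable {d N : ℕ}

/-- Restricting a link tuple to a sub-support does not increase the sup-distance. [folklore] -/
theorem dist_restrict_le {Λ Λ' : Finset (ZdEdge d)} (h : Λ ⊆ Λ')
    (U V : LGConfig d (Matrix.specialUnitaryGroup (Fin N) ℂ)) :
    dist (fun e : ↥Λ => suEntries (U e)) (fun e : ↥Λ => suEntries (V e)) ≤
      dist (fun e : ↥Λ' => suEntries (U e)) (fun e : ↥Λ' => suEntries (V e)) := by
  refine (dist_pi_le_iff dist_nonneg).2 fun e => ?_
  exact dist_le_pi_dist (fun e : ↥Λ' => suEntries (U e)) (fun e : ↥Λ' => suEntries (V e)) ⟨e.1, h e.2⟩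

/-- **The product of two bounded Lipschitz cylinder functions is a Lipschitz cylinder function** on the union
of the supports, with constant `M₁ K₂ + M₂ K₁` (`|Fᵢ| ≤ Mᵢ`): `|F₁F₂(U) − F₁F₂(V)| ≤ |F₁(U)||F₂(U) − F₂(V)| +
|F₂(V)||F₁(U) − F₁(V)|`, then McShane packaging (`isLipschitzCylinder_of_dist_le`). [folklore] -/
theorem isLipschitzCylinder_mul [DecidableEq (ZdEdge d)]
    {F₁ F₂ : LGConfig d (Matrix.specialUnitaryGroup (Fin N) ℂ) → ℝ} {Λ₁ Λ₂ : Finset (ZdEdge d)}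
    {K₁ K₂ M₁ M₂ : ℝ≥0}
    (h₁ : IsLipschitzCylinder (fundamentalRep (Fin N)) F₁ Λ₁ K₁)
    (h₂ : IsLipschitzCylinder (fundamentalRep (Fin N)) F₂ Λ₂ K₂)
    (hM₁ : ∀ U, |F₁ U| ≤ M₁) (hM₂ : ∀ U, |F₂ U| ≤ M₂) :
    IsLipschitzCylinder (fundamentalRep (Fin N)) (fun U => F₁ U * F₂ U) (Λ₁ ∪ Λ₂) (M₁ * K₂ + M₂ * K₁) := by
  obtain ⟨f₁, hf₁, hF₁⟩ := h₁.exists_suEntries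
  obtain ⟨f₂, hf₂, hF₂⟩ := h₂.exists_suEntries
  refine ZdSmoothing.isLipschitzCylinder_of_dist_le fun U V => ?_
  set δ := dist (fun e : ↥(Λ₁ ∪ Λ₂) => suEntries (U e)) (fun e : ↥(Λ₁ ∪ Λ₂) => suEntries (V e)) with hδ
  have hd₁ : |F₁ U - F₁ V| ≤ K₁ * δ := by
    rw [hF₁, hF₁, ← Real.dist_eq]
    exact (hf₁.dist_le_mul _ _).trans
      (mul_le_mul_of_nonneg_left (dist_restrict_le Finset.subset_union_left U V) K₁.2)
  have hd₂ : |F₂ U - F₂ V| ≤ K₂ * δ := by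
    rw [hF₂, hF₂, ← Real.dist_eq]
    exact (hf₂.dist_le_mul _ _).trans
      (mul_le_mul_of_nonneg_left (dist_restrict_le Finset.subset_union_right U V) K₂.2)
  have hδ0 : 0 ≤ δ := dist_nonneg
  calc |F₁ U * F₂ U - F₁ V * F₂ V| = |F₁ U * (F₂ U - F₂ V) + F₂ V * (F₁ U - F₁ V)| := by ring_nf
    _ ≤ |F₁ U| * |F₂ U - F₂ V| + |F₂ V| * |F₁ U - F₁ V| := by
        refine (abs_add_le _ _).trans ?_; rw [abs_mul, abs_mul]
    _ ≤ M₁ * (K₂ * δ) + M₂ * (K₁ * δ) :=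
        add_le_add (mul_le_mul (hM₁ U) hd₂ (abs_nonneg _) M₁.2) (mul_le_mul (hM₂ V) hd₁ (abs_nonneg _) M₂.2)
    _ = ((M₁ * K₂ + M₂ * K₁ : ℝ≥0) : ℝ) * δ := by push_cast; ring

end Product

/-! ### §3 Torus covariances converge to the covariances of the unique DLR state -/

section Covariance

variable {d N : ℕ} {G : Type*} [Group G] [TopologicalSpace G] [IsTopologicalGroup G] [CompactSpace G]
  [MeasurableSpace G] [BorelSpace G] [T2Space G] [SecondCountableTopology G]
  (ρ : G →* Matrix (Fin N) (Fin N) ℂ)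

/-- The covariance of two bounded measurable observables under a probability measure, in moments. [folklore] -/
theorem covariance_eq_sub_of_abs_le {Ω : Type*} [MeasurableSpace Ω] {μ : Measure Ω} [IsProbabilityMeasure μ]
    {X Y : Ω → ℝ} (hX : Measurable X) (hY : Measurable Y) {A B : ℝ} (hA : ∀ ω, |X ω| ≤ A) (hB : ∀ ω, |Y ω| ≤ B) :
    cov[X, Y; μ] = (∫ ω, X ω * Y ω ∂μ) - (∫ ω, X ω ∂μ) * ∫ ω, Y ω ∂μ := by
  have lX : MemLp X 2 μ := memLp_of_bounded (a := -A) (b := A)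
    (ae_of_all _ fun ω => abs_le.1 (hA ω)) hX.aestronglyMeasurable 2
  have lY : MemLp Y 2 μ := memLp_of_bounded (a := -B) (b := B)
    (ae_of_all _ fun ω => abs_le.1 (hB ω)) hY.aestronglyMeasurable 2
  exact covariance_eq_sub lX lY

/-- **Torus covariances converge to the covariances of the unique DLR state**: if `𝒢(ymSpecification ρ β)` has at
most one element `μ`, then for bounded continuous observables `Φ₁, Φ₂` of `ℤ^d`,
`Cov_{torusState ρ β (L+1)}(Φ₁, Φ₂) → Cov_μ(Φ₁, Φ₂)` as `L → ∞`. [folklore] -/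
theorem tendsto_cov_torusState_of_subsingleton (hρ : Continuous ρ) {β : ℝ}
    (hsub : (ymGibbsMeasures (d := d) ρ β).Subsingleton)
    {μ : Measure (LGConfig d G)} (hμ : μ ∈ ymGibbsMeasures ρ β)
    {Φ₁ Φ₂ : LGConfig d G → ℝ} (h₁ : Continuous Φ₁) (h₂ : Continuous Φ₂)
    {A B : ℝ} (hA : ∀ U, |Φ₁ U| ≤ A) (hB : ∀ U, |Φ₂ U| ≤ B) :
    Tendsto (fun L : ℕ => cov[Φ₁, Φ₂; torusState ρ β (L + 1)]) atTop (𝓝 (cov[Φ₁, Φ₂; μ])) := by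
  haveI := fun L : ℕ => isProbabilityMeasure_torusState (d := d) (L := L + 1) ρ hρ β
  haveI : IsProbabilityMeasure μ := hμ.1
  have h₁m : Measurable Φ₁ := h₁.measurable
  have h₂m : Measurable Φ₂ := h₂.measurable
  have hAB : ∀ U, |Φ₁ U * Φ₂ U| ≤ A * B := fun U => by
    rw [abs_mul]; exact mul_le_mul (hA U) (hB U) (abs_nonneg _) ((abs_nonneg _).trans (hA U))
  have t12 := tendsto_integral_torusState_of_subsingleton ρ hρ hsub hμ (h₁.mul h₂) hAB
  have t1 := tendsto_integral_torusState_of_subsingleton ρ hρ hsub hμ h₁ hA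
  have t2 := tendsto_integral_torusState_of_subsingleton ρ hρ hsub hμ h₂ hB
  have e : ∀ L : ℕ, cov[Φ₁, Φ₂; torusState ρ β (L + 1)] =
      (∫ U, Φ₁ U * Φ₂ U ∂(torusState ρ β (L + 1))) - (∫ U, Φ₁ U ∂(torusState ρ β (L + 1))) *
        ∫ U, Φ₂ U ∂(torusState ρ β (L + 1)) := fun L => covariance_eq_sub_of_abs_le h₁m h₂m hA hB
  simp_rw [e]
  rw [covariance_eq_sub_of_abs_le h₁m h₂m hA hB]
  exact t12.sub (t1.mul t2)

end Covariance

end Summit.Ventures.YMGap.CouplingResponse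

end
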